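import Literature.IUT.HodgeTheaters.PuncturedEllipticGeomOriginIota
import Mathlib.Tactic.Group
import HarnessLib

/-!
# [IUTchI] §1 p. 38 l. 1 — the law (L3) «`ι` acts on `Δ_E ⊗ (ℤ/lℤ)` via multiplication by `−1`» REDUCED, over the origin
# record `GeomOriginIota`, to the label-free cusp-span sentence «`⁅Δ_X, Δ_X⁆⁻` dies in `Δ_E ⊗ ℤ/l`» (proof-only)

Mochizuki, *Inter-universal Teichmüller theory I*, kurims manuscript (May 2020), §1 p. 37 l. 30 – p. 38 l. 1 ("`Δ_X̲ ↠ Δ_X̲^{ab} ⊗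
(ℤ/lℤ) ↠ Δ_ε` … a natural exact sequence `0 → I_ε′ × I_ε″ → Δ_ε → Δ_E ⊗ (ℤ/lℤ) → 0` … `ι` acts on `Δ_E ⊗ (ℤ/lℤ)` via multiplication
by `−1`") [cite: Mochizuki2012, IUTchI §1 pp.37-38] (D-0012 claim key; series status DISPUTED — nothing of the series is asserted
here); [EtTh] §2 Def. 2.1 p. 33 (`C = X/{±1}`) [cite: MochizukiEtTh2009, Def 2.1 p.33].

PROOF-ONLY file (cell abc-iut, seat abc-iut-L5-t1 gen 11, sequel of R46 «GEOMORIGIN-IOTA-FIELD» p501139; by-name input for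
abc-iut-L5-d4's R45 «COR12-MODL-LAWS-DERIVE@M_l» descent; GAP-LEDGER G-L5t1g11-4).  Two steps, no definition, no new `Prop` fact:
* `GeomOriginIota.conj_mul_mem_closure_commutator_of_not_mem_piX` — **EVERY `c ∈ Δ_C ∖ Π_X` acts by `−1` on `Δ_X^{ab}`**:
  `c v c⁻¹ v ∈ ⁅Δ_X, Δ_X⁆⁻` for `v ∈ Δ_X` (write `c = x ι⁻¹`, `x := c ι ∈ Δ_X`; then `c v c⁻¹ v = (x n x⁻¹)·[x, v⁻¹]` with
  `n := ι⁻¹ v ι v ∈ ⁅Δ_X,Δ_X⁆⁻` by `GeomOriginIota.iota_conj_mul_mem_closure_commutator`);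
* `GeomOriginIota.iota_neg_of_closure_commutator_le` — **the clause (L3) `ModLCuspLaws.iota_neg`** («`ι̲ v ι̲⁻¹ · v ∈ I_ε′ · I_ε″ ·
  Ker(Δ_X̲ ↠ Δ_ε)` for `ι̲ ∈ Δ_C̲ ∖ Δ_X̲`, `v ∈ Δ_X̲`», the binders `hL3 hL3′` of the Cor. 1.2 closer of record) **follows from the
  record and the single cusp-span sentence (CS) `⁅Δ_X, Δ_X⁆⁻ ≤ I_ε′ ⊔ I_ε″ ⊔ Ker(Δ_X̲ ↠ Δ_ε)`** («the commutators of `Δ_X` die in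
  `Δ_E ⊗ ℤ/l = Δ_ε/(I_ε′ × I_ε″)`» — classically: the image of `⁅Δ_X,Δ_X⁆ = ⟨⟨[a,b]⟩⟩⁻` in `H₁(X̲; 𝔽_l)` is the span of the `l`
  cusp classes, which is what `Δ_X̲ ↠ Δ_E ⊗ ℤ/l` kills; label-free except for naming `ε′, ε″` among the killed cusps).
So of the six residual LAW binders of `…_of_geomOrigin_ex48_rational`, `hL3 hL3′` reduce to (CS) ×2 over `GeomOriginIota` records.

HONEST FRAMING: classical group theory over a hypothesis/origin record asserted for no instance; (CS) is displayed, not proved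
(it is a cusp-exhaustion statement about the typed cusps of the datum); nothing here bears on [IUTchIII] Cor. 3.12 or asserts that
abc is proved or refuted.
-/

noncomputable section

namespace Literature.IUT.HodgeTheaters

namespace PuncturedEllipticData

namespace GeomOriginIota

open Literature.AnabelianGeometry.AbsoluteAnabelian

universe u

variable {D : PuncturedEllipticData.{u}}

/-- **Every element of `Δ_C ∖ Π_X` acts by `−1` on `Δ_X^{ab}`**: `c v c⁻¹ v ∈ ⁅Δ_X, Δ_X⁆⁻` for `c ∈ Δ_C`, `c ∉ Π_X`, `v ∈ Δ_X`
(`c = x ι⁻¹` with `x = c ι ∈ Δ_X`; `ι` inverts `Δ_X^{ab}`). ([IUTchI] §1 p.38) [claim: Mochizuki2012, status: disputed] -/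
theorem conj_mul_mem_closure_commutator_of_not_mem_piX (O : D.GeomOriginIota) {c : D.PiC} (hc : c ∈ D.DeltaC)
    (hcX : c ∉ D.PiX) {v : D.PiC} (hv : v ∈ D.PiX ⊓ D.DeltaC) :
    c * v * c⁻¹ * v ∈ (⁅D.PiX ⊓ D.DeltaC, D.PiX ⊓ D.DeltaC⁆).topologicalClosure := by
  haveI hΔn : (D.PiX ⊓ D.DeltaC).Normal := by
    haveI := D.piX_normal
    haveI : D.DeltaC.Normal := D.E.normal_geom
    exact Subgroup.normal_inf_normal D.PiX D.DeltaC
  haveI hNn : (⁅D.PiX ⊓ D.DeltaC, D.PiX ⊓ D.DeltaC⁆).topologicalClosure.Normal :=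
    Subgroup.is_normal_topologicalClosure _
  have hx : c * O.iota ∈ D.PiX ⊓ D.DeltaC := O.mul_iota_mem_deltaX hc hcX
  -- `n := ι⁻¹ v ι v ∈ ⁅Δ_X,Δ_X⁆⁻` (from `ι w ι⁻¹ w ∈ ⁅Δ_X,Δ_X⁆⁻` at `w := ι⁻¹ v ι`)
  have hw : O.iota⁻¹ * v * O.iota ∈ D.PiX ⊓ D.DeltaC := by
    have h := hΔn.conj_mem v hv O.iota⁻¹
    rwa [inv_inv] at h
  have hn0 := O.iota_conj_mul_mem_closure_commutator hw
  have hvw : v * (O.iota⁻¹ * v * O.iota) ∈ (⁅D.PiX ⊓ D.DeltaC, D.PiX ⊓ D.DeltaC⁆).topologicalClosure := by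
    have he : O.iota * (O.iota⁻¹ * v * O.iota) * O.iota⁻¹ * (O.iota⁻¹ * v * O.iota) = v * (O.iota⁻¹ * v * O.iota) := by
      group
    rwa [he] at hn0
  have hn : O.iota⁻¹ * v * O.iota * v ∈ (⁅D.PiX ⊓ D.DeltaC, D.PiX ⊓ D.DeltaC⁆).topologicalClosure := by
    have he : O.iota⁻¹ * v * O.iota * v =
        (O.iota⁻¹ * v * O.iota) * (v * (O.iota⁻¹ * v * O.iota)) * (O.iota⁻¹ * v * O.iota)⁻¹ := by group
    rw [he]
    exact hNn.conj_mem _ hvw _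
  -- `c v c⁻¹ v = (x n x⁻¹) · [x, v⁻¹]`
  have hid : c * v * c⁻¹ * v = ((c * O.iota) * (O.iota⁻¹ * v * O.iota * v) * (c * O.iota)⁻¹) *
      ((c * O.iota) * v⁻¹ * (c * O.iota)⁻¹ * v⁻¹⁻¹) := by group
  rw [hid]
  exact mul_mem (hNn.conj_mem _ hn _)
    (Subgroup.le_topologicalClosure _ (Subgroup.commutator_mem_commutator hx (inv_mem hv)))

/-- **(L3) `ModLCuspLaws.iota_neg` from the origin record and the cusp-span sentence (CS)** `⁅Δ_X, Δ_X⁆⁻ ≤ I_ε′ ⊔ I_ε″ ⊔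
Ker(Δ_X̲ ↠ Δ_ε)`: for `ι̲ ∈ Δ_C̲ ∖ Δ_X̲` and `v ∈ Δ_X̲`, `ι̲ v ι̲⁻¹ v ∈ I_ε′ ⊔ I_ε″ ⊔ Ker(Δ_X̲ ↠ Δ_ε)` — "`ι` acts on `Δ_E ⊗ (ℤ/lℤ)`
via multiplication by `−1`" (p. 38 l. 1); EXACTLY the binder `hL3` of `…_of_geomOrigin_ex48_rational`.
([IUTchI] §1 p.38) [claim: Mochizuki2012, status: disputed] -/
theorem iota_neg_of_closure_commutator_le (O : D.GeomOriginIota)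
    (hCS : (⁅D.PiX ⊓ D.DeltaC, D.PiX ⊓ D.DeltaC⁆).topologicalClosure ≤
      D.inertia D.ε1 ⊔ D.inertia D.ε2 ⊔ D.deltaEpsKer) :
    ∀ c ∈ D.DeltaCbar, c ∉ D.DeltaXbar → ∀ v ∈ D.DeltaXbar,
      c * v * c⁻¹ * v ∈ D.inertia D.ε1 ⊔ D.inertia D.ε2 ⊔ D.deltaEpsKer := by
  intro c hc hcX v hv
  have hcC : c ∈ D.DeltaC := (Subgroup.mem_inf.mp hc).2
  have hcCbar : c ∈ D.PiCbar := (Subgroup.mem_inf.mp hc).1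
  have hcX' : c ∉ D.PiX := fun h =>
    hcX (Subgroup.mem_inf.mpr ⟨Subgroup.mem_inf.mpr ⟨h, hcCbar⟩, hcC⟩)
  have hvΔ : v ∈ D.PiX ⊓ D.DeltaC :=
    Subgroup.mem_inf.mpr ⟨(Subgroup.mem_inf.mp (D.deltaXbar_le_piXbar hv)).1, (Subgroup.mem_inf.mp hv).2⟩
  exact hCS (O.conj_mul_mem_closure_commutator_of_not_mem_piX hcC hcX' hvΔ)

end GeomOriginIota

end PuncturedEllipticData

end Literature.IUT.HodgeTheaters

end
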